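import Mathlib.Analysis.Analytic.Basic
import Mathlib.MeasureTheory.Integral.IntervalIntegral.Basic
import Mathlib.MeasureTheory.Function.L2Space
import Mathlib.MeasureTheory.Function.LocallyIntegrable
import Mathlib.LinearAlgebra.Matrix.PosDef
import Literature.MathematicalPhysics.QuantumLattice.RandomField
import Literature.MathematicalPhysics.QuantumLattice.EuclideanAction
import HarnessLib

-- provenance: harness21/H21/H21/Prelude/QLatticeAQFT/OSAxiomsMeasure.lean @ b6a64e5 (interim HEAD d8f2665); M5 mechanical rewrite
/-!
# Osterwalder–Schrader axioms for Euclidean measures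

Trunk **T-AQFT** (G13, Part A, item A5 / design decision A-D1), families `constructive-qft`,
`crit-ising`. Notion: `os_axioms` (measure form).

A Euclidean quantum field theory in the sense of Glimm–Jaffe is a probability measure `μ` on
real tempered distributions `𝒮'(ℝ^d)` (here `Literature.AQFT.FieldConfig (EuclideanSpace ℝ (Fin d))`)
whose generating functional `S(f) = ∫ exp (i ω(f)) dμ(ω)` satisfies

* **OS0** (analyticity): `z ↦ S(∑ zᵢ fᵢ)` is entire on `ℂⁿ` — `IsOS0Analytic`, together with the
  exponential-moment side condition `HasExponentialMoments` making the complex integrand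
  integrable;
* **OS1** (regularity): `|S(f)| ≤ exp c (‖f‖_{L¹} + ‖f‖_{Lᵖ}ᵖ)` for *complex* `f`, some
  `1 ≤ p ≤ 2`, plus local integrability of the two-point kernel when `p = 2` — `IsOS1Regular`
  (Glimm–Jaffe (6.1.3));
* **OS2** (Euclidean invariance) — `IsOS2Invariant := IsEuclideanInvariantLaw`;
* **OS3** (reflection positivity): `∑ᵢⱼ c̄ᵢ cⱼ S(fⱼ - θfᵢ) ≥ 0` for positive-time `fᵢ` —
  `IsOS3ReflectionPositive` (Glimm–Jaffe (6.1.4));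
* **OS4** (ergodicity): time averages `T⁻¹ ∫₀ᵀ F(T_t ω) dt → ∫ F dμ` in `L²(μ)` —
  `IsOS4Ergodic` (Glimm–Jaffe (6.1.5)); the (under OS0–OS3 equivalent) clustering form
  `S(f + T_t g) → S(f) S(g)` is `IsOS4Clustering`.

These are bundled in `structure IsOSMeasure`. For the mass-gap statements (cqft.S03) we also
provide `HasExponentialClustering μ m` (exponential decay, at rate `m`, of the truncated
two-point function `⟨ω(f); ω(T_t g)⟩` for `f` supported at *negative* and `g` at *positive*
times — the transfer-matrix form `⟨θf̄ Ω, e^{-tH} g Ω⟩` of Glimm–Jaffe Thm 6.2.4 / §19.7) and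
`osMassGap μ` (the supremal such rate).

**Deviation from the outline (for the architect).** The outline (`QLatticeAQFT.md` §A5, l.385)
transcribes `HasExponentialClustering` with `f, g` ranging over *all* Schwartz functions. That
predicate is false for every massive theory with a positive two-point kernel (free field,
`P(φ)₂`): Schwartz tails like `exp (-√‖x‖)` make `⟨f, C_m T_t g⟩` decay only
sub-exponentially, so `osMassGap` would be the junk value `0` and cqft.S03 unsatisfiable. The
time-separated form used here is the one under which the free field of mass `m` clusters at rate
exactly `m` (`IsFreeField.hasExponentialClustering` in `Statements/ConstructiveQFT/OSAxioms`).

The *abstract* (Hilbert-space / transfer-operator) analogues `Literature.Probability.LatticeModels.IsOSRealisation` and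
`Literature.Probability.LatticeModels.HasTimeClustering` live in G02 (`Literature.Prelude.StatMech.TransferOperator`); this file
does not import them, the link (OS reconstruction) is a target statement elsewhere.

## Sources

* J. Glimm, A. Jaffe, *Quantum Physics: a functional integral point of view* (2nd ed. 1987),
  §6.1, axioms OS0–OS4, eqs. (6.1.2)–(6.1.5); §19.7 (ergodicity ⇔ uniqueness of the vacuum
  ⇔ clustering).
* K. Osterwalder, R. Schrader, *Axioms for Euclidean Green's functions I, II*, Comm. Math. Phys.
  31 (1973), 42 (1975).
* Design reference: the `OSforGFF` Lean project (OS axioms for the Gaussian free field), whose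
  measure-form axioms have the same shape.

## Mathlib

Used: `AnalyticOnNhd` (entire functions on `Fin n → ℂ`), `intervalIntegral` (time averages),
`MeasureTheory.eLpNorm` (`L²(μ)` convergence stated on representatives, no quotient needed),
`MeasureTheory.LocallyIntegrable`, `Matrix.PosSemidef` (with the scoped `ComplexOrder`).
Searched and absent at the pin: any Osterwalder–Schrader / reflection-positivity vocabulary
(`Osterwalder`, `reflectionPositiv`, `ReflectionPositive`), ergodicity of a one-parameter group
in `L²` form for measures on duals of Schwartz space.

## Design

* No `abbrev` for `EuclideanSpace ℝ (Fin d)` (outline §0). Axioms that do not refer to the time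
  direction (OS0, OS1, OS2, exponential moments) are stated over a generic real normed space `E`
  (with `[MeasureSpace E]` for the `Lᵖ` norms of OS1), exactly as in `RandomField`; OS3, OS4,
  `IsOSMeasure`, clustering and the mass gap use `EuclideanSpace ℝ (Fin d)` with `[NeZero d]`
  (time = coordinate `0`, from `EuclideanAction`).
* Glimm–Jaffe's `S{f}` in OS0/OS1 is evaluated at *complex* test functions (for real `f` and a
  probability measure `|S(f)| ≤ 1` trivially, so OS1 would be vacuous). Since configurations are
  real distributions, a complex test function is represented by its real and imaginary parts
  `(f, g)`, and `genFunctionalC μ f g = ∫ exp (i ω(f) - ω(g)) dμ = S{f + i g}`.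
* OS4 is given in both forms (outline: "ergodic vs clustering both given"); `IsOSMeasure` uses the
  ergodic form of Glimm–Jaffe, and `IsOS4Ergodic.clustering` records the implication under the
  other axioms.
* Junk values: `timeAverage` at `T = 0` is `0` (factor `T⁻¹`); `osMassGap` is `sSup` of a
  possibly empty or unbounded set of reals, hence `0` in those cases (documented below); Bochner
  integrals of non-integrable functions are `0` (OS0's analyticity is therefore paired with
  `HasExponentialMoments`).
-/

open scoped SchwartzMap ComplexConjugate ComplexOrder
open MeasureTheory Filter Topology Complex

namespace Literature.MathematicalPhysics.QuantumLattice

/-! ### OS0, OS1, OS2 (generic Euclidean space) -/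

section Generic

variable {E : Type*} [NormedAddCommGroup E] [NormedSpace ℝ E]

/-- The generating functional at the *complex* test function `f + i g` (`f, g` real):
`S{f + i g} = ∫ exp (i ω(f) - ω(g)) dμ(ω)`. Bochner integral, junk value `0` if the integrand is
not integrable (it is under `HasExponentialMoments`). Glimm–Jaffe §6.1, (6.1.1)–(6.1.2). [folklore] -/
noncomputable def genFunctionalC (μ : Measure (FieldConfig E)) (f g : 𝓢(E, ℝ)) : ℂ :=
  ∫ ω, cexp (I * (ω f : ℂ) - (ω g : ℂ)) ∂μ

/-- At a real test function the complex generating functional is the usual one: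
`S{f + i 0} = S{f}`. Glimm–Jaffe §6.1. [folklore] -/
@[simp]
theorem genFunctionalC_zero_right (μ : Measure (FieldConfig E)) (f : 𝓢(E, ℝ)) :
    genFunctionalC μ f 0 = genFunctional μ f := by
  simp [genFunctionalC, genFunctional]

/-- `μ` has *exponential moments*: `ω ↦ exp (ω(f))` is integrable for every real test function
`f`. Since `-f` and `a • f` are again test functions and `exp |x| ≤ exp x + exp (-x)`, this is
equivalent to integrability of `exp (a |ω(f)|)` for all `a`, and it makes the integrands of
`genFunctionalC` and of OS0 integrable. In terms of Mathlib's one-dimensional vocabulary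
(`ProbabilityTheory.integrableExpSet` in `Mathlib/Probability/Moments/IntegrableExpMul.lean`,
`ProbabilityTheory.mgf` in `Mathlib/Probability/Moments/Basic.lean`) it says `1 ∈ integrableExpSet (fun ω => ω f) μ` for
every `f`, i.e. every real random variable `ω(f)` has a finite moment generating function.
Glimm–Jaffe §6.1 (implicit in OS0/OS1). [folklore] -/
def HasExponentialMoments (μ : Measure (FieldConfig E)) : Prop :=
  ∀ f : 𝓢(E, ℝ), Integrable (fun ω : FieldConfig E => Real.exp (ω f)) μ

/-- **OS0 (analyticity)**, Glimm–Jaffe §6.1: `μ` has exponential moments and, for every finite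
family of real test functions `f₁, …, fₙ`, the function
`z ↦ S{∑ᵢ zᵢ fᵢ} = ∫ exp (i ∑ᵢ zᵢ ω(fᵢ)) dμ(ω)` is entire on `ℂⁿ`. [folklore] -/
def IsOS0Analytic (μ : Measure (FieldConfig E)) : Prop :=
  HasExponentialMoments μ ∧
    ∀ (n : ℕ) (f : Fin n → 𝓢(E, ℝ)),
      AnalyticOnNhd ℂ (fun z : Fin n → ℂ => ∫ ω, cexp (I * ∑ i, z i * (ω (f i) : ℂ)) ∂μ)
        Set.univ

variable [MeasureSpace E]

/-- **OS1 (regularity)**, Glimm–Jaffe §6.1, (6.1.3): for the exponents `1 ≤ p ≤ 2` and the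
constant `c`, for all complex test functions `h = f + i g`,
`|S{h}| ≤ exp (c (‖h‖_{L¹} + ‖h‖_{Lᵖ}ᵖ))`, and, in the case `p = 2`, the two-point function
has a locally integrable kernel: `∫ ω(f) ω(g) dμ = ∫∫ S₂(x, y) f(x) g(y) dx dy` with `S₂` locally
integrable on `E × E`. [folklore] -/
def IsOS1Regular (μ : Measure (FieldConfig E)) (p c : ℝ) : Prop :=
  1 ≤ p ∧ p ≤ 2 ∧
    (∀ f g : 𝓢(E, ℝ),
      ‖genFunctionalC μ f g‖ ≤
        Real.exp (c * ((∫ x, ‖((f x : ℂ) + I * g x)‖) + ∫ x, ‖((f x : ℂ) + I * g x)‖ ^ p))) ∧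
    (p = 2 →
      ∃ S₂ : E → E → ℝ,
        LocallyIntegrable (Function.uncurry S₂) (volume.prod volume) ∧
          ∀ f g : 𝓢(E, ℝ), twoPoint μ f g = ∫ x, ∫ y, S₂ x y * f x * g y)

omit [MeasureSpace E] in
/-- **OS2 (Euclidean invariance)**, Glimm–Jaffe §6.1: `μ` is invariant under the full Euclidean
group of `E`; by definition `IsEuclideanInvariantLaw μ` from `EuclideanAction`. [folklore] -/
abbrev IsOS2Invariant (μ : Measure (FieldConfig E)) : Prop :=
  IsEuclideanInvariantLaw μ

end Generic

/-! ### OS3, OS4 (fixed dimension, time = coordinate `0`) -/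

section Time

variable (d : ℕ) [NeZero d]

/-- **OS3 (reflection positivity)**, Glimm–Jaffe §6.1, (6.1.4): for all finite families of
positive-time real test functions `fᵢ` and complex coefficients `cᵢ`, the number
`∑ᵢⱼ c̄ᵢ cⱼ S{fⱼ - θ fᵢ}` is a nonnegative real (this is `⟨θA, A⟩_{L²(μ)} ≥ 0` for
`A = ∑ cᵢ exp (i ω(fᵢ))`). [folklore] -/
def IsOS3ReflectionPositive (μ : Measure (FieldConfig (EuclideanSpace ℝ (Fin d)))) : Prop :=
  ∀ (n : ℕ) (c : Fin n → ℂ) (f : Fin n → 𝓢(EuclideanSpace ℝ (Fin d), ℝ)),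
    (∀ i, IsPositiveTime (f i)) →
      let z := ∑ i, ∑ j, conj (c i) * c j * genFunctional μ (f j - thetaTest d (f i))
      0 ≤ z.re ∧ z.im = 0

/-- The time average `T⁻¹ ∫₀ᵀ F(T_t ω) dt` of an observable `F` along the time-translation flow
`timeShiftField` on configurations. Junk: `0` at `T = 0`; the interval integral is `0` if
`t ↦ F (T_t ω)` is not integrable on `[0, T]`. Glimm–Jaffe §6.1, (6.1.5). [folklore] -/
noncomputable def timeAverage {G : Type*} [NormedAddCommGroup G] [NormedSpace ℝ G]
    (T : ℝ) (F : FieldConfig (EuclideanSpace ℝ (Fin d)) → G)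
    (ω : FieldConfig (EuclideanSpace ℝ (Fin d))) : G :=
  T⁻¹ • ∫ t in (0 : ℝ)..T, F (timeShiftField d t ω)

/-- **OS4 (ergodicity)**, Glimm–Jaffe §6.1, (6.1.5): the time-translation group acts ergodically
on `(𝒮', μ)`, in von Neumann's mean-ergodic form: for every `F ∈ L²(μ)` the time averages
`T⁻¹ ∫₀ᵀ F ∘ T_t dt` converge in `L²(μ)` to the constant `∫ F dμ` as `T → ∞`. [folklore] -/
def IsOS4Ergodic (μ : Measure (FieldConfig (EuclideanSpace ℝ (Fin d)))) : Prop :=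
  ∀ F : FieldConfig (EuclideanSpace ℝ (Fin d)) → ℂ, MemLp F 2 μ →
    Tendsto (fun T : ℝ => eLpNorm (fun ω => timeAverage d T F ω - ∫ ω', F ω' ∂μ) 2 μ)
      atTop (𝓝 0)

/-- **OS4, clustering form** (Glimm–Jaffe §6.1 and §19.7; Osterwalder–Schrader 1973, E4): for all
real test functions `f, g`, `S{f + T_t g} → S{f} S{g}` as `t → +∞`. Under OS0–OS3 this is
equivalent to `IsOS4Ergodic` (`IsOS4Ergodic.clustering`). [cite: OsterwalderSchrader1973, E4] -/
def IsOS4Clustering (μ : Measure (FieldConfig (EuclideanSpace ℝ (Fin d)))) : Prop :=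
  ∀ f g : 𝓢(EuclideanSpace ℝ (Fin d), ℝ),
    Tendsto (fun t : ℝ => genFunctional μ (f + timeShiftTest d t g)) atTop
      (𝓝 (genFunctional μ f * genFunctional μ g))

/-- A measure `μ` on `𝒮'(ℝ^d)` *satisfies the Osterwalder–Schrader axioms* (Glimm–Jaffe §6.1):
it is a probability measure satisfying OS0 (analyticity, with exponential moments), OS1
(regularity (6.1.3) for some `1 ≤ p ≤ 2` and `c`), OS2 (Euclidean invariance), OS3 (reflection
positivity (6.1.4)) and OS4 (ergodicity (6.1.5)). Abstract analogue:
`Literature.Probability.LatticeModels.IsOSRealisation` (G02). [folklore] -/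
structure IsOSMeasure (μ : Measure (FieldConfig (EuclideanSpace ℝ (Fin d)))) : Prop where
  /-- `μ` is a probability measure. -/
  isProbabilityMeasure : IsProbabilityMeasure μ
  /-- OS0: analyticity of the generating functional (with exponential moments). -/
  os0 : IsOS0Analytic μ
  /-- OS1: regularity bound (6.1.3) for some `1 ≤ p ≤ 2` and constant `c`. -/
  os1 : ∃ p c : ℝ, IsOS1Regular μ p c
  /-- OS2: Euclidean invariance. -/
  os2 : IsOS2Invariant μ
  /-- OS3: reflection positivity (6.1.4). -/
  os3 : IsOS3ReflectionPositive d μ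
  /-- OS4: ergodicity of time translations (6.1.5). -/
  os4 : IsOS4Ergodic d μ

/-- *Exponential clustering at rate `m > 0`* (time-separated form): for all real test functions
`f` supported at negative times (`θf` positive-time) and `g` supported at positive times there
is a constant `C` with `|⟨ω(f); ω(T_t g)⟩_μ| ≤ C e^{-m t}` for all `t ≥ 0` (truncated two-point
function `truncatedTwoPoint`; `T_t g` is supported at times `> t`). In the reconstructed Hilbert
space this is `|⟨θf̄ Ω, e^{-tH} g Ω⟩ - ⟨θf̄ Ω, Ω⟩⟨Ω, g Ω⟩| ≤ C e^{-mt}`, i.e. a spectral gap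
`≥ m` of `H` on the one-particle states — the mass-gap conclusion of cqft.S03 in measure form;
the abstract transfer-operator analogue is `Literature.Probability.LatticeModels.HasTimeClustering` (G02).
The restriction to time-separated supports is essential: over *all* Schwartz `f, g` the bound
fails already for the free field of mass `m` (sub-exponential Schwartz tails), see the module
docstring. Glimm–Jaffe §6.1, Thm 6.2.4, §19.7. [folklore] -/
def HasExponentialClustering (μ : Measure (FieldConfig (EuclideanSpace ℝ (Fin d)))) (m : ℝ) :
    Prop :=
  0 < m ∧
    ∀ f g : 𝓢(EuclideanSpace ℝ (Fin d), ℝ), IsPositiveTime (thetaTest d f) → IsPositiveTime g →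
      ∃ C : ℝ, ∀ t : ℝ, 0 ≤ t →
        |truncatedTwoPoint μ f (timeShiftTest d t g)| ≤ C * Real.exp (-m * t)

/-- The *OS mass gap* of `μ`: the supremum of the exponential clustering rates `m` of the
truncated two-point function at time-separated test functions (`HasExponentialClustering`).
Junk value: `sSup` (the instance `Real.instSupSet`) of an empty set (no clustering) or of a set
unbounded above (e.g. vanishing truncated two-point function) is `0`; consumers assert
`HasExponentialClustering μ m` for an explicit `m` instead when this matters.
Glimm–Jaffe §6.1, §19.7. [folklore] -/
noncomputable def osMassGap (μ : Measure (FieldConfig (EuclideanSpace ℝ (Fin d)))) : ℝ :=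
  sSup {m : ℝ | HasExponentialClustering d μ m}

end Time

/-! ### API -/

section API

variable {E : Type*} [NormedAddCommGroup E] [NormedSpace ℝ E]
variable {d : ℕ} [NeZero d]

/-- Exponential moments give all polynomial moments; in particular every evaluation `ω ↦ ω(f)`
is integrable. Glimm–Jaffe §6.1 (OS0 ⇒ Schwinger functions exist, Prop. 6.1.4). [cite: GlimmJaffeQP1987, §6.1 Prop. 6.1.4] -/
def HasExponentialMoments.integrable_eval : Prop :=
  ∀ {μ : Measure (FieldConfig E)} [IsFiniteMeasure μ] (hμ : HasExponentialMoments μ) (f : 𝓢(E, ℝ)),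
    Integrable (fun ω : FieldConfig E => ω f) μ

/-- Exponential moments give all moments (`HasAllMoments`). Glimm–Jaffe §6.1, Prop. 6.1.4. [cite: GlimmJaffeQP1987, §6.1 Prop. 6.1.4] -/
def HasExponentialMoments.hasAllMoments : Prop :=
  ∀ {μ : Measure (FieldConfig E)} [IsFiniteMeasure μ] (hμ : HasExponentialMoments μ),
    HasAllMoments μ

/-- For an OS measure every evaluation `ω ↦ ω(f)` is integrable (from OS0's exponential
moments). Glimm–Jaffe §6.1, Prop. 6.1.4. [folklore] -/
def IsOSMeasure.integrable_eval : Prop :=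
  ∀ {μ : Measure (FieldConfig (EuclideanSpace ℝ (Fin d)))} (hμ : IsOSMeasure d μ) (f : 𝓢(EuclideanSpace ℝ (Fin d), ℝ)),
    Integrable (fun ω : FieldConfig (EuclideanSpace ℝ (Fin d)) => ω f) μ

/- interim proof relied on results that are now named facts (D-0014); demoted to a fact by the M5 import, proof preserved:
:=
  haveI := hμ.isProbabilityMeasure
  hμ.os0.1.integrable_eval f
-/

/-- Reflection positivity in matrix form: for positive-time `f₁, …, fₙ` the matrix
`Mᵢⱼ = S{fⱼ - θ fᵢ}` is positive semidefinite (Hermitian with nonnegative quadratic form).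
Glimm–Jaffe §6.1, (6.1.4). Hermitian symmetry of `M` follows by polarisation from the
hypothesis that `c̄ᵀ M c` is real for *all* `c ∈ ℂⁿ`; no further property of `μ` is needed. [cite: GlimmJaffeQP1987, §6.1 (6.1.4)] -/
def IsOS3ReflectionPositive.posSemidef : Prop :=
  ∀ {μ : Measure (FieldConfig (EuclideanSpace ℝ (Fin d)))} (hμ : IsOS3ReflectionPositive d μ) {n : ℕ} (f : Fin n → 𝓢(EuclideanSpace ℝ (Fin d), ℝ)) (hf : ∀ i, IsPositiveTime (f i)),
    (Matrix.of fun i j : Fin n => genFunctional μ (f j - thetaTest d (f i))).PosSemidef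

/-- Exponential clustering is antitone in the rate: clustering at rate `m` implies clustering at
every smaller positive rate `m'`. Glimm–Jaffe §6.1. [folklore] -/
theorem HasExponentialClustering.anti {μ : Measure (FieldConfig (EuclideanSpace ℝ (Fin d)))}
    {m m' : ℝ} (hμ : HasExponentialClustering d μ m) (hm' : 0 < m') (hle : m' ≤ m) :
    HasExponentialClustering d μ m' := by
  refine ⟨hm', fun f g hf hg => ?_⟩
  obtain ⟨C, hC⟩ := hμ.2 f g hf hg
  refine ⟨max C 0, fun t ht => (hC t ht).trans ?_⟩
  have h1 : Real.exp (-m * t) ≤ Real.exp (-m' * t) := Real.exp_le_exp.2 (by nlinarith)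
  calc C * Real.exp (-m * t) ≤ max C 0 * Real.exp (-m * t) :=
        mul_le_mul_of_nonneg_right (le_max_left _ _) (Real.exp_pos _).le
    _ ≤ max C 0 * Real.exp (-m' * t) := mul_le_mul_of_nonneg_left h1 (le_max_right _ _)

/-- Under OS2 and OS3 (for a probability measure), ergodicity of time translations implies
(indeed is equivalent to) clustering of the generating functional, both being equivalent to
uniqueness of the vacuum of the reconstructed Hamiltonian (Glimm–Jaffe state this "under
OS0–OS3"; OS0/OS1 are not used in the implication). Glimm–Jaffe §6.1 and Thm 19.7.1, plus OS2 to
move `f, g` to positive times. [cite: GlimmJaffeQP1987, §6.1 and Thm. 19.7.1] -/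
def IsOS4Ergodic.clustering : Prop :=
  ∀ {μ : Measure (FieldConfig (EuclideanSpace ℝ (Fin d)))} [IsProbabilityMeasure μ] (h4 : IsOS4Ergodic d μ) (h2 : IsOS2Invariant μ) (h3 : IsOS3ReflectionPositive d μ),
    IsOS4Clustering d μ

/-- An OS measure satisfies the clustering form of OS4. Glimm–Jaffe §6.1, §19.7. [folklore] -/
def IsOSMeasure.clustering : Prop :=
  ∀ {μ : Measure (FieldConfig (EuclideanSpace ℝ (Fin d)))} (hμ : IsOSMeasure d μ),
    IsOS4Clustering d μ

/- interim proof relied on results that are now named facts (D-0014); demoted to a fact by the M5 import, proof preserved: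
:=
  haveI := hμ.isProbabilityMeasure
  hμ.os4.clustering hμ.os2 hμ.os3
-/

/-- The generating functional of an OS measure is positive definite on all of `𝒮` (not only on
positive-time functions): this is just Bochner positivity of a probability law, recorded here for
contrast with OS3. Gel'fand–Vilenkin IV §3. [folklore] -/
def IsOSMeasure.isPositiveDefiniteFunctional : Prop :=
  ∀ {μ : Measure (FieldConfig (EuclideanSpace ℝ (Fin d)))} (hμ : IsOSMeasure d μ),
    IsPositiveDefiniteFunctional (genFunctional μ)

/- interim proof relied on results that are now named facts (D-0014); demoted to a fact by the M5 import, proof preserved: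
:=
  haveI := hμ.isProbabilityMeasure
  (isCharacteristicFunctional_genFunctional μ).2.2
-/

end API

/-! ### Discharges (D-0014: the named facts above that follow from Mathlib) -/

section Discharge

variable {E : Type*} [NormedAddCommGroup E] [NormedSpace ℝ E]
variable {d : ℕ} [NeZero d]

/-- Under `HasExponentialMoments`, every real `t` lies in Mathlib's
`ProbabilityTheory.integrableExpSet` of the random variable `ω ↦ ω f`, because
`t * ω f = ω (t • f)` and `t • f` is again a test function (Glimm–Jaffe §6.1, proof of
Prop. 6.1.4: exponential integrability in every direction). [cite: GlimmJaffeQP1987, §6.1 Prop. 6.1.4] -/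
theorem HasExponentialMoments.integrableExpSet_eq_univ {μ : Measure (FieldConfig E)}
    (hμ : HasExponentialMoments μ) (f : 𝓢(E, ℝ)) :
    ProbabilityTheory.integrableExpSet (fun ω : FieldConfig E => ω f) μ = Set.univ := by
  ext t
  simp only [ProbabilityTheory.integrableExpSet, Set.mem_setOf_eq, Set.mem_univ, iff_true]
  have h := hμ (t • f)
  simpa [map_smul, smul_eq_mul] using h

/-- **Discharge of `HasExponentialMoments.hasAllMoments`** (Glimm–Jaffe §6.1, Prop. 6.1.4:
"OS0 ⇒ moments of all orders"): exponential moments in every direction put `0` in the interior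
of `integrableExpSet`, whence all `Lᵖ` moments by
`ProbabilityTheory.memLp_of_mem_interior_integrableExpSet`. (The finiteness hypothesis of the
fact is not even needed.) [cite: GlimmJaffeQP1987, §6.1 Prop. 6.1.4] -/
theorem HasExponentialMoments.hasAllMoments_holds :
    HasExponentialMoments.hasAllMoments (E := E) := by
  intro μ _ hμ p f
  exact ProbabilityTheory.memLp_of_mem_interior_integrableExpSet
    (by simp [hμ.integrableExpSet_eq_univ f]) p

/-- **Discharge of `HasExponentialMoments.integrable_eval`** (Glimm–Jaffe §6.1, Prop. 6.1.4):
first moments exist, by `ProbabilityTheory.integrable_of_mem_interior_integrableExpSet`. [cite: GlimmJaffeQP1987, §6.1 Prop. 6.1.4] -/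
theorem HasExponentialMoments.integrable_eval_holds :
    HasExponentialMoments.integrable_eval (E := E) := by
  intro μ _ hμ f
  exact ProbabilityTheory.integrable_of_mem_interior_integrableExpSet
    (by simp [hμ.integrableExpSet_eq_univ f])

/-- **Discharge of `IsOSMeasure.integrable_eval`**: OS0 contains `HasExponentialMoments`
(Glimm–Jaffe §6.1, Prop. 6.1.4). [cite: GlimmJaffeQP1987, §6.1 Prop. 6.1.4] -/
theorem IsOSMeasure.integrable_eval_holds : IsOSMeasure.integrable_eval (d := d) := by
  intro μ hμ f
  haveI := hμ.isProbabilityMeasure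
  exact HasExponentialMoments.integrable_eval_holds hμ.os0.1 f

/-- All moments of an OS measure exist (`HasAllMoments`), from OS0 (Glimm–Jaffe §6.1,
Prop. 6.1.4). [cite: GlimmJaffeQP1987, §6.1 Prop. 6.1.4] -/
theorem IsOSMeasure.hasAllMoments {μ : Measure (FieldConfig (EuclideanSpace ℝ (Fin d)))}
    (hμ : IsOSMeasure d μ) : HasAllMoments μ := by
  haveI := hμ.isProbabilityMeasure
  exact HasExponentialMoments.hasAllMoments_holds hμ.os0.1

end Discharge

end Literature.MathematicalPhysics.QuantumLattice
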